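import Mathlib.RingTheory.MvPolynomial.WeightedHomogeneous
import Mathlib.RingTheory.FiniteType
import Mathlib.RingTheory.RegularLocalRing.Polynomial
import Mathlib.Algebra.Order.Antidiag.Finsupp
import Mathlib.Algebra.MonoidAlgebra.MapDomain
import Mathlib.Algebra.MonoidAlgebra.Basic
import Mathlib.RingTheory.Localization.Away.Basic
import Literature.AlgebraicGeometry.Resolution.AffineBlowupAlgebra
import Literature.AlgebraicGeometry.Resolution.AffineBlowup
import HarnessLib

/-!
# Cone programme: the chart of `Bl_{VM} V(n,r)` at `xᵢʳ` is an affine `n`-space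

Support file for crux stmt-ResolutionOfSingularities-15317 (`FrobeniusLadder.FRationalResolution`), line `redirect`,
lead c5, CONE PROGRAMME (rung 4′ in all dimensions on the Veronese cones `V(n,r) = Spec k[χᵈ : |d| = r]`).
Stub `stub_veronese_chart_isRegularRing`. Let `A = VR[n,r] ⊆ P = k[x₁,…,xₙ]` be the `r`-th Veronese
subring (`r ≥ 1`), `VM ⊆ A` its vertex ideal (spanned by the degree-`r` monomials `χᵈ`). The affine
blowup algebra `B = A[VM/xᵢʳ] ⊆ L = A[1/xᵢʳ]` (image model, `blowupAlgebra`) is the polynomial ring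
`k[xᵢʳ, xⱼ/xᵢ (j ≠ i)]`: the ring map `ψ : k[T₁,…,Tₙ] → B`, `Tᵢ ↦ xᵢʳ`, `Tⱼ ↦ (xⱼxᵢʳ⁻¹)/xᵢʳ = xⱼ/xᵢ`
(`j ≠ i`) is SURJECTIVE (`B` is generated over `A` by the `χᵈ/xᵢʳ`, `|d| = r`, and the monomial
identity `χᵈ · (xᵢʳ)ʳ = xᵢʳ · Πⱼ (xⱼxᵢʳ⁻¹)^{dⱼ}` gives `χᵈ/xᵢʳ = Πⱼ (xⱼ/xᵢ)^{dⱼ}` in `L`, with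
`xᵢ/xᵢ = 1`) and INJECTIVE (`xᵢʳ` is a unit of the Laurent ring `k[ℤⁿ] ⊇ P ⊇ A`, so `A ⊆ k[ℤⁿ]`
extends to `λ : L → k[ℤⁿ]`, and `λ ∘ ψ` is the monomial map `k[ℕⁿ] → k[ℤⁿ]` along the injective
exponent map `θ(e) = e + (r eᵢ − |e|) εᵢ`). Hence `B ≅ k[T₁,…,Tₙ]` is regular
(`IsRegularRing.of_ringEquiv`). All folklore (Kollár, *Lectures on resolution of singularities*
(2007), §2.2; Fulton, *Introduction to toric varieties*, §2.6); only Mathlib and the tree's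
`div_mem_blowupAlgebra` are used (template: `…ToricXChartRegular.lean`); no named facts. -/

-- single-problem summit: the doubled namespace component is forced
set_option linter.dupNamespace false

noncomputable section

namespace Summit.ResolutionOfSingularities.ResolutionOfSingularities.Theorems.FRationalResolution

open MvPolynomial
open Literature.AlgebraicGeometry.Resolution

section Cones

variable (k : Type) [Field k]

/-- The polynomial ring in `n` variables. -/
local notation3 "MP[" n "]" => MvPolynomial (Fin n) k

/-- The `r`-th Veronese subring of `k[x₁,…,xₙ]`: the `k`-subalgebra generated by the degree-`r` monomials. -/
local notation3 "VR[" n ", " r "]" =>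
  Algebra.adjoin k ((fun d : Fin n →₀ ℕ => MvPolynomial.monomial d (1 : k)) ''
    {d : Fin n →₀ ℕ | Finsupp.degree d = (r : ℕ)})

/-- The vertex ideal of the Veronese cone: spanned by the degree-`r` monomials. -/
local notation3 "VM[" n ", " r "]" =>
  Ideal.span {v : ↥VR[n, r] | ∃ d : Fin n →₀ ℕ, Finsupp.degree d = (r : ℕ) ∧
    (v : MvPolynomial (Fin n) k) = MvPolynomial.monomial d 1}

/-- The Laurent polynomial ring `k[ℤⁿ]` (coordinate ring of the `n`-torus). -/
local notation3 "LR[" n "]" => AddMonoidAlgebra k (Fin n →₀ ℤ)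

/-- The monomial `xⱼ · xᵢ^{r-1}` is `χ^{εⱼ + (r-1)εᵢ}`. [folklore] -/
theorem veroneseConeChart_X_mul_X_pow_eq (n r : ℕ) (i j : Fin n) :
    (MvPolynomial.X j * MvPolynomial.X i ^ (r - 1) : MP[n]) =
      MvPolynomial.monomial (Finsupp.single j 1 + Finsupp.single i (r - 1)) 1 := by
  rw [MvPolynomial.X_pow_eq_monomial, MvPolynomial.X, MvPolynomial.monomial_mul, mul_one]

/-- For `1 ≤ r` the exponent `εⱼ + (r-1)εᵢ` has total degree `r`. [folklore] -/
theorem veroneseConeChart_degree_single_add (n r : ℕ) (hr : 1 ≤ r) (i j : Fin n) :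
    Finsupp.degree (Finsupp.single j 1 + Finsupp.single i (r - 1)) = r := by
  rw [map_add, Finsupp.degree_single, Finsupp.degree_single]
  omega

/-- For `1 ≤ r` the degree-`r` monomial `xⱼ · xᵢ^{r-1}` lies in the Veronese subring `VR[n,r]`.
[folklore] -/
theorem veroneseConeChart_X_mul_X_pow_mem (n r : ℕ) (hr : 1 ≤ r) (i j : Fin n) :
    (MvPolynomial.X j * MvPolynomial.X i ^ (r - 1) : MP[n]) ∈ VR[n, r] :=
  Algebra.subset_adjoin ⟨Finsupp.single j 1 + Finsupp.single i (r - 1),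
    veroneseConeChart_degree_single_add n r hr i j,
    (veroneseConeChart_X_mul_X_pow_eq k n r i j).symm⟩

/-- **Generation of `A[VM/xᵢʳ]` over `A`.** A subring `T ⊆ A[1/xᵢʳ]` (`A = VR[n,r]`) containing
the image of `A` and the fractions `χᵈ/xᵢʳ` (`|d| = r`) contains `A[VM/xᵢʳ]`: it is generated over
`A` by the `v/xᵢʳ`, `v ∈ VM`, `v ↦ v/xᵢʳ` is `A`-linear, and `VM` is spanned by the `χᵈ`.
[folklore] -/
theorem veroneseConeChart_mem_of_mem_blowupAlgebra (n r : ℕ) (xi : ↥VR[n, r])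
    (T : Subring (Localization.Away xi))
    (hA : ∀ s : ↥VR[n, r], algebraMap (↥VR[n, r]) (Localization.Away xi) s ∈ T)
    (hgen : ∀ (v : ↥VR[n, r]) (d : Fin n →₀ ℕ), Finsupp.degree d = r →
      (v : MP[n]) = MvPolynomial.monomial d 1 →
      algebraMap (↥VR[n, r]) (Localization.Away xi) v * IsLocalization.Away.invSelf xi ∈ T)
    {w : Localization.Away xi} (hw : w ∈ blowupAlgebra VM[n, r] xi) : w ∈ T := by
  induction hw using Algebra.adjoin_induction with
  | mem w hw =>
    obtain ⟨v, hv, rfl⟩ := hw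
    induction hv using Submodule.span_induction with
    | mem v hv =>
      obtain ⟨d, hd, hvd⟩ := hv
      exact hgen v d hd hvd
    | zero => simpa only [map_zero, zero_mul] using T.zero_mem
    | add v v' _ _ hv hv' => simpa only [map_add, add_mul] using T.add_mem hv hv'
    | smul c v _ hv => simpa only [smul_eq_mul, map_mul, mul_assoc] using T.mul_mem (hA c) hv
  | algebraMap s => exact hA s
  | add w₁ w₂ _ _ hw₁ hw₂ => exact T.add_mem hw₁ hw₂
  | mul w₁ w₂ _ _ hw₁ hw₂ => exact T.mul_mem hw₁ hw₂

/-- **The monomial identity** `χᵈ · (xᵢʳ)ʳ = xᵢʳ · Πⱼ (xⱼ xᵢ^{r-1})^{dⱼ}` in `k[x₁,…,xₙ]` for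
`|d| = r ≥ 1` (both sides are `χᵈ · xᵢ^{r²}`, as `Σⱼ dⱼ = r`). [folklore] -/
theorem veroneseConeChart_monomial_mul_pow (n r : ℕ) (hr : 1 ≤ r) (i : Fin n) (d : Fin n →₀ ℕ)
    (hd : Finsupp.degree d = r) :
    (MvPolynomial.monomial d (1 : k) : MP[n]) * (MvPolynomial.X i ^ r) ^ r =
      MvPolynomial.X i ^ r * ∏ j, (MvPolynomial.X j * MvPolynomial.X i ^ (r - 1)) ^ d j := by
  have hsum : ∑ j, d j = r := by rw [← Finsupp.degree_eq_sum]; exact hd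
  have hmon : (MvPolynomial.monomial d (1 : k) : MP[n]) = ∏ j, MvPolynomial.X j ^ d j := by
    rw [MvPolynomial.monomial_eq, MvPolynomial.C_1, one_mul, Finsupp.prod_fintype]
    exact fun j => pow_zero _
  have hprod : ∏ j, (MvPolynomial.X j * MvPolynomial.X i ^ (r - 1) : MP[n]) ^ d j =
      (∏ j, MvPolynomial.X j ^ d j) * (MvPolynomial.X i ^ (r - 1)) ^ r := by
    simp_rw [mul_pow]
    rw [Finset.prod_mul_distrib, Finset.prod_pow_eq_pow_sum, hsum]
  rw [hprod, hmon, show ((MvPolynomial.X i : MP[n]) ^ r) ^ r =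
    MvPolynomial.X i ^ r * (MvPolynomial.X i ^ (r - 1)) ^ r by
      rw [← mul_pow, ← pow_succ', Nat.sub_add_cancel hr]]
  ring

/-- **`χᵈ = xᵢʳ · Πⱼ (xⱼ/xᵢ)^{dⱼ}` in `A[1/xᵢʳ]`** for a degree-`r` monomial `χᵈ ∈ A = VR[n,r]`
(`r ≥ 1`; `xⱼ/xᵢ` denotes `(xⱼxᵢ^{r-1})/xᵢʳ`): read `χᵈ · (xᵢʳ)ʳ = xᵢʳ · Πⱼ (xⱼ xᵢ^{r-1})^{dⱼ}` in
`A` and divide by `(xᵢʳ)ʳ = Πⱼ (xᵢʳ)^{dⱼ}`. [folklore] -/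
theorem veroneseConeChart_algebraMap_monomial (n r : ℕ) (hr : 1 ≤ r) (i : Fin n)
    (xi : ↥VR[n, r]) (hxi : (xi : MP[n]) = MvPolynomial.X i ^ r) (v : ↥VR[n, r])
    (d : Fin n →₀ ℕ) (hd : Finsupp.degree d = r) (hv : (v : MP[n]) = MvPolynomial.monomial d 1) :
    algebraMap (↥VR[n, r]) (Localization.Away xi) v =
      algebraMap (↥VR[n, r]) (Localization.Away xi) xi *
        ∏ j, (algebraMap (↥VR[n, r]) (Localization.Away xi)
          ⟨MvPolynomial.X j * MvPolynomial.X i ^ (r - 1),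
            veroneseConeChart_X_mul_X_pow_mem k n r hr i j⟩ *
          IsLocalization.Away.invSelf xi) ^ d j := by
  -- the monomial identity, read in `A`
  have key : v * xi ^ r = xi * ∏ j, (⟨MvPolynomial.X j * MvPolynomial.X i ^ (r - 1),
      veroneseConeChart_X_mul_X_pow_mem k n r hr i j⟩ : ↥VR[n, r]) ^ d j := by
    apply Subtype.ext
    rw [Subalgebra.coe_mul, Subalgebra.coe_mul, Subalgebra.coe_pow, SubmonoidClass.coe_finsetProd,
      hv, hxi]
    simp_rw [Subalgebra.coe_pow]
    exact veroneseConeChart_monomial_mul_pow k n r hr i d hd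
  -- divide by `(xᵢʳ)ʳ`
  set f := algebraMap (↥VR[n, r]) (Localization.Away xi)
  set u := IsLocalization.Away.invSelf (S := Localization.Away xi) xi
  have hinv : f xi * u = 1 := IsLocalization.Away.mul_invSelf xi
  have hsum : ∑ j, d j = r := by rw [← Finsupp.degree_eq_sum]; exact hd
  calc f v = f v * (f xi * u) ^ r := by rw [hinv, one_pow, mul_one]
    _ = f (v * xi ^ r) * u ^ r := by rw [map_mul, map_pow, mul_pow, mul_assoc]
    _ = f xi * (∏ j, f ⟨MvPolynomial.X j * MvPolynomial.X i ^ (r - 1),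
          veroneseConeChart_X_mul_X_pow_mem k n r hr i j⟩ ^ d j) * u ^ (∑ j, d j) := by
        rw [key, map_mul, map_prod, hsum]
        simp_rw [map_pow]
    _ = f xi * ∏ j, (f ⟨MvPolynomial.X j * MvPolynomial.X i ^ (r - 1),
          veroneseConeChart_X_mul_X_pow_mem k n r hr i j⟩ * u) ^ d j := by
        rw [← Finset.prod_pow_eq_pow_sum, mul_assoc, ← Finset.prod_mul_distrib]
        simp_rw [mul_pow]

/-- **The image of `A` is reached.** For `A = VR[n,r]` (`1 ≤ r`), a subring `T ⊆ A[1/xᵢʳ]`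
containing the image of `k`, the element `xᵢʳ` and the fractions `xⱼ/xᵢ = (xⱼxᵢ^{r-1})/xᵢʳ`
contains the image of `A`: `A` is generated over `k` by the degree-`r` monomials `χᵈ`, and
`χᵈ = xᵢʳ · Πⱼ (xⱼ/xᵢ)^{dⱼ}` in `A[1/xᵢʳ]`. [folklore] -/
theorem veroneseConeChart_algebraMap_mem (n r : ℕ) (hr : 1 ≤ r) (i : Fin n) (xi : ↥VR[n, r])
    (hxi : (xi : MP[n]) = MvPolynomial.X i ^ r) (T : Subring (Localization.Away xi))
    (hC : ∀ c : k,
      algebraMap (↥VR[n, r]) (Localization.Away xi) (algebraMap k (↥VR[n, r]) c) ∈ T)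
    (h₀ : algebraMap (↥VR[n, r]) (Localization.Away xi) xi ∈ T)
    (hy : ∀ j : Fin n, algebraMap (↥VR[n, r]) (Localization.Away xi)
        ⟨MvPolynomial.X j * MvPolynomial.X i ^ (r - 1),
          veroneseConeChart_X_mul_X_pow_mem k n r hr i j⟩ *
        IsLocalization.Away.invSelf xi ∈ T)
    (s : ↥VR[n, r]) : algebraMap (↥VR[n, r]) (Localization.Away xi) s ∈ T := by
  obtain ⟨s, hs⟩ := s
  induction hs using Algebra.adjoin_induction with
  | mem s hs =>
    obtain ⟨d, hd, rfl⟩ := hs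
    generalize_proofs hmem
    rw [veroneseConeChart_algebraMap_monomial k n r hr i xi hxi ⟨_, hmem⟩ d hd rfl]
    exact T.mul_mem h₀ (prod_mem fun j _ => T.pow_mem (hy j) _)
  | algebraMap c => exact hC c
  | add s t _ _ hs ht => have hst := T.add_mem hs ht; rwa [← map_add] at hst
  | mul s t _ _ hs ht => have hst := T.mul_mem hs ht; rwa [← map_mul] at hst

/-- **Injectivity by the torus embedding.** Let `φ : k[T₁,…,Tₙ] → A[1/xᵢʳ]` (`A = VR[n,r]`,
`r ≥ 1`) be a ring map with `φ c = c`, `φ Tᵢ = xᵢʳ`, `φ Tⱼ = (xⱼxᵢ^{r-1})/xᵢʳ` (`j ≠ i`). Then `φ`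
is injective: `xᵢʳ = χ^{rεᵢ}` is a unit of the Laurent ring `k[ℤⁿ]`, so `A ⊆ k[x₁,…,xₙ] ⊆ k[ℤⁿ]`
extends to `λ : A[1/xᵢʳ] → k[ℤⁿ]` (`IsLocalization.Away.lift`), and `λ ∘ φ` is the monomial map
`k[ℕⁿ] → k[ℤⁿ]` (`AddMonoidAlgebra.mapDomain`) along `θ(e) = e + (r eᵢ − |e|) εᵢ` (`Tᵢ ↦ χ^{rεᵢ}`,
`Tⱼ ↦ χ^{εⱼ − εᵢ}`), injective as `θ(e)ⱼ = eⱼ` (`j ≠ i`) and `|θ(e)| = r eᵢ`. [folklore] -/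
theorem veroneseConeChart_injective (n r : ℕ) (hr : 1 ≤ r) (i : Fin n) (xi : ↥VR[n, r])
    (hxi : (xi : MP[n]) = MvPolynomial.X i ^ r)
    (φ : MP[n] →+* Localization.Away xi)
    (hφC : ∀ c, φ (MvPolynomial.C c) =
      algebraMap (↥VR[n, r]) (Localization.Away xi) (algebraMap k (↥VR[n, r]) c))
    (hφi : φ (MvPolynomial.X i) = algebraMap (↥VR[n, r]) (Localization.Away xi) xi)
    (hφj : ∀ j, j ≠ i → φ (MvPolynomial.X j) =
      algebraMap (↥VR[n, r]) (Localization.Away xi)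
        ⟨MvPolynomial.X j * MvPolynomial.X i ^ (r - 1),
          veroneseConeChart_X_mul_X_pow_mem k n r hr i j⟩ *
        IsLocalization.Away.invSelf xi) :
    Function.Injective φ := by
  -- the cast of exponents `ℕⁿ → ℤⁿ` and the Laurent embedding `Λ : A → k[ℤⁿ]`
  let ι : (Fin n →₀ ℕ) →+ (Fin n →₀ ℤ) := Finsupp.mapRange.addMonoidHom (Nat.castAddMonoidHom ℤ)
  have hι : ∀ (e : Fin n →₀ ℕ) (l : Fin n), ι e l = (e l : ℤ) := fun e l => rfl
  let Λ : ↥VR[n, r] →+* LR[n] :=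
    (AddMonoidAlgebra.mapDomainRingHom k ι).comp (VR[n, r]).val.toRingHom
  have hΛ : ∀ s : ↥VR[n, r], Λ s = AddMonoidAlgebra.mapDomain ι (s : MP[n]) := fun s => rfl
  have hΛxi : Λ xi = AddMonoidAlgebra.single (Finsupp.single i (r : ℤ)) 1 := by
    rw [hΛ, hxi, MvPolynomial.X_pow_eq_monomial, ← MvPolynomial.single_eq_monomial,
      AddMonoidAlgebra.mapDomain_single]
    congr 1
    ext l
    rw [hι, Finsupp.single_apply, Finsupp.single_apply, Nat.cast_ite, Nat.cast_zero]
  have hunit : IsUnit (Λ xi) := by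
    rw [hΛxi]
    refine IsUnit.of_mul_eq_one (AddMonoidAlgebra.single (Finsupp.single i (-(r : ℤ))) (1 : k)) ?_
    rw [AddMonoidAlgebra.single_mul_single, mul_one, AddMonoidAlgebra.one_def,
      ← Finsupp.single_add, add_neg_cancel, Finsupp.single_zero]
  -- the extension `λ : A[1/xᵢʳ] → k[ℤⁿ]` of `Λ`
  have hlift : ∀ s : ↥VR[n, r], IsLocalization.Away.lift (S := Localization.Away xi) xi hunit
      (algebraMap (↥VR[n, r]) (Localization.Away xi) s) = Λ s :=
    fun s => IsLocalization.Away.lift_eq xi hunit s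
  have hinv : Λ xi * IsLocalization.Away.lift (S := Localization.Away xi) xi hunit
      (IsLocalization.Away.invSelf xi) = 1 := by
    rw [← hlift xi, ← map_mul, IsLocalization.Away.mul_invSelf, map_one]
  -- the exponent map `θ(e) = e + (r eᵢ - |e|) εᵢ`
  let θ : (Fin n →₀ ℕ) →+ (Fin n →₀ ℤ) :=
    { toFun := fun e => ι e + Finsupp.single i ((r : ℤ) * (e i : ℤ) - ((Finsupp.degree e : ℕ) : ℤ))
      map_zero' := by simp
      map_add' := fun e e' => by
        ext l
        simp only [map_add, Finsupp.add_apply, hι, Nat.cast_add, Finsupp.single_apply]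
        split_ifs <;> ring }
  have hθ_apply : ∀ e : Fin n →₀ ℕ,
      θ e = ι e + Finsupp.single i ((r : ℤ) * (e i : ℤ) - ((Finsupp.degree e : ℕ) : ℤ)) :=
    fun e => rfl
  have hdegι : ∀ e : Fin n →₀ ℕ, Finsupp.degree (ι e) = ((Finsupp.degree e : ℕ) : ℤ) := by
    intro e
    simp only [Finsupp.degree_eq_sum, hι, Nat.cast_sum]
  -- `θ` is injective: `|θ(e)| = r eᵢ` recovers `eᵢ`, and `θ(e)ₗ = eₗ` for `l ≠ i`
  have hθ : Function.Injective θ := by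
    intro e e' h
    have hi' : e i = e' i := by
      have h1 := congrArg Finsupp.degree h
      simp only [hθ_apply, map_add, hdegι, Finsupp.degree_single, add_sub_cancel] at h1
      have hr0 : (r : ℤ) ≠ 0 := by exact_mod_cast (by omega : r ≠ 0)
      exact_mod_cast mul_left_cancel₀ hr0 h1
    ext l
    by_cases hl : l = i
    · rw [hl, hi']
    · have h1 := DFunLike.congr_fun h l
      simp only [hθ_apply, Finsupp.add_apply, hι, Finsupp.single_apply, if_neg (Ne.symm hl),
        add_zero] at h1
      exact_mod_cast h1
  -- `λ ∘ φ` is the monomial map along `θ`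
  have hcomp : (IsLocalization.Away.lift (S := Localization.Away xi) xi hunit).comp φ =
      AddMonoidAlgebra.mapDomainRingHom k θ := by
    refine MvPolynomial.ringHom_ext (fun c => ?_) (fun j => ?_)
    · rw [RingHom.comp_apply, hφC, hlift, hΛ, Subalgebra.coe_algebraMap,
        MvPolynomial.algebraMap_eq, AddMonoidAlgebra.mapDomainRingHom_apply,
        MvPolynomial.C_apply, ← MvPolynomial.single_eq_monomial,
        AddMonoidAlgebra.mapDomain_single, AddMonoidAlgebra.mapDomain_single, map_zero, map_zero]
    · by_cases hj : j = i
      · rw [hj, RingHom.comp_apply, hφi, hlift, hΛxi, AddMonoidAlgebra.mapDomainRingHom_apply,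
          MvPolynomial.X, ← MvPolynomial.single_eq_monomial, AddMonoidAlgebra.mapDomain_single]
        congr 1
        ext l
        rw [hθ_apply, Finsupp.add_apply, hι, Finsupp.degree_single, Finsupp.single_eq_same]
        simp only [Finsupp.single_apply]
        split_ifs <;> simp
      · -- `Λ (xⱼ xᵢ^{r-1}) = χ^{θ(εⱼ)} · Λ (xᵢʳ)`, i.e. `εⱼ + (r-1)εᵢ = (εⱼ - εᵢ) + rεᵢ`
        have hmj : Λ ⟨MvPolynomial.X j * MvPolynomial.X i ^ (r - 1),
            veroneseConeChart_X_mul_X_pow_mem k n r hr i j⟩ =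
            AddMonoidAlgebra.single (θ (Finsupp.single j 1)) 1 * Λ xi := by
          rw [hΛ, hΛxi, AddMonoidAlgebra.single_mul_single, mul_one]
          change AddMonoidAlgebra.mapDomain ι
            (MvPolynomial.X j * MvPolynomial.X i ^ (r - 1) : MP[n]) = _
          rw [veroneseConeChart_X_mul_X_pow_eq, ← MvPolynomial.single_eq_monomial,
            AddMonoidAlgebra.mapDomain_single]
          congr 1
          ext l
          rw [map_add, Finsupp.add_apply, Finsupp.add_apply, hι, hι, hθ_apply, Finsupp.add_apply,
            hι, Finsupp.degree_single]
          simp only [Finsupp.single_apply, hj, if_false, Nat.cast_ite, Nat.cast_one,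
            Nat.cast_zero, mul_zero, zero_sub]
          split_ifs
          all_goals omega
        rw [RingHom.comp_apply, hφj j hj, map_mul, hlift, hmj, mul_assoc, hinv, mul_one,
          AddMonoidAlgebra.mapDomainRingHom_apply, MvPolynomial.X,
          ← MvPolynomial.single_eq_monomial, AddMonoidAlgebra.mapDomain_single]
  refine Function.Injective.of_comp
    (f := IsLocalization.Away.lift (S := Localization.Away xi) xi hunit) ?_
  rw [← RingHom.coe_comp, hcomp]
  exact AddMonoidAlgebra.mapDomain_injective hθ

/-- **The chart parametrisation is bijective.** For `A = VR[n,r]` (`r ≥ 1`), a ring map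
`ψ : k[T₁,…,Tₙ] → A[VM/xᵢʳ]` with `ψ c = c`, `ψ Tᵢ = xᵢʳ`, `ψ Tⱼ = (xⱼxᵢ^{r-1})/xᵢʳ` (`j ≠ i`) is
bijective: injective by the torus embedding (`veroneseConeChart_injective` for `ψ` followed by
`A[VM/xᵢʳ] ⊆ A[1/xᵢʳ]`), surjective by generation (`veroneseConeChart_mem_of_mem_blowupAlgebra`,
`veroneseConeChart_algebraMap_mem`; the remaining fraction `xᵢxᵢ^{r-1}/xᵢʳ` is `1`). [folklore] -/
theorem veroneseConeChart_bijective (n r : ℕ) (hr : 1 ≤ r) (i : Fin n) (xi : ↥VR[n, r])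
    (hxi : (xi : MP[n]) = MvPolynomial.X i ^ r) (ψ : MP[n] →+* ↥(blowupAlgebra VM[n, r] xi))
    (hψC : ∀ c, (ψ (MvPolynomial.C c) : Localization.Away xi) =
      algebraMap (↥VR[n, r]) (Localization.Away xi) (algebraMap k (↥VR[n, r]) c))
    (hψi : (ψ (MvPolynomial.X i) : Localization.Away xi) =
      algebraMap (↥VR[n, r]) (Localization.Away xi) xi)
    (hψj : ∀ j, j ≠ i → (ψ (MvPolynomial.X j) : Localization.Away xi) =
      algebraMap (↥VR[n, r]) (Localization.Away xi)
        ⟨MvPolynomial.X j * MvPolynomial.X i ^ (r - 1),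
          veroneseConeChart_X_mul_X_pow_mem k n r hr i j⟩ *
        IsLocalization.Away.invSelf xi) :
    Function.Bijective ψ := by
  letI hAlg : Algebra (↥VR[n, r]) ↥(blowupAlgebra VM[n, r] xi) :=
    (blowupAlgebra VM[n, r] xi).algebra
  -- `ψ` followed by the inclusion `A[VM/xᵢʳ] ⊆ A[1/xᵢʳ]`
  let φ : MP[n] →+* Localization.Away xi := (blowupAlgebra VM[n, r] xi).val.toRingHom.comp ψ
  have hφ : ∀ p, φ p = (ψ p : Localization.Away xi) := fun p => rfl
  -- injectivity (torus embedding)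
  have hφinj : Function.Injective φ :=
    veroneseConeChart_injective k n r hr i xi hxi φ (fun c => (hφ _).trans (hψC c))
      ((hφ _).trans hψi) (fun j hj => (hφ _).trans (hψj j hj))
  refine ⟨fun p q hpq => hφinj ((hφ p).trans ((congrArg Subtype.val hpq).trans (hφ q).symm)),
    fun b => ?_⟩
  -- surjectivity (generation): all the fractions `xⱼ/xᵢ` lie in the range (`xᵢ/xᵢ = 1`)
  have hy : ∀ j : Fin n, algebraMap (↥VR[n, r]) (Localization.Away xi)
      ⟨MvPolynomial.X j * MvPolynomial.X i ^ (r - 1),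
        veroneseConeChart_X_mul_X_pow_mem k n r hr i j⟩ *
      IsLocalization.Away.invSelf xi ∈ φ.range := by
    intro j
    by_cases hj : j = i
    · have hm : (⟨MvPolynomial.X j * MvPolynomial.X i ^ (r - 1),
          veroneseConeChart_X_mul_X_pow_mem k n r hr i j⟩ : ↥VR[n, r]) = xi :=
        Subtype.ext (show (MvPolynomial.X j * MvPolynomial.X i ^ (r - 1) : MP[n]) = (xi : MP[n])
          by rw [hj, hxi, ← pow_succ', Nat.sub_add_cancel hr])
      rw [hm, IsLocalization.Away.mul_invSelf]
      exact φ.range.one_mem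
    · exact RingHom.mem_range.mpr ⟨MvPolynomial.X j, (hφ _).trans (hψj j hj)⟩
  have hA : ∀ s, algebraMap (↥VR[n, r]) (Localization.Away xi) s ∈ φ.range :=
    veroneseConeChart_algebraMap_mem k n r hr i xi hxi φ.range
      (fun c => RingHom.mem_range.mpr ⟨_, (hφ _).trans (hψC c)⟩)
      (RingHom.mem_range.mpr ⟨_, (hφ _).trans hψi⟩) hy
  -- hence all the `χᵈ/xᵢʳ = Πⱼ (xⱼ/xᵢ)^{dⱼ}` do, and the range is everything
  obtain ⟨p, hp⟩ := RingHom.mem_range.mp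
    (veroneseConeChart_mem_of_mem_blowupAlgebra k n r xi φ.range hA (fun v d hd hv => by
      rw [veroneseConeChart_algebraMap_monomial k n r hr i xi hxi v d hd hv, mul_right_comm,
        IsLocalization.Away.mul_invSelf, one_mul]
      exact prod_mem fun j _ => pow_mem (hy j) _) b.2)
  exact ⟨p, Subtype.ext hp⟩

/-- **THE CHART OF `Bl_{VM} V(n,r)` AT `xᵢʳ` IS AN AFFINE `n`-SPACE** (registered stub
`stub_veronese_chart_isRegularRing`, crux stmt-ResolutionOfSingularities-15317, line `redirect`).
For `1 ≤ r`, the affine blowup algebra `VR[n,r][VM/xᵢʳ] ⊆ VR[n,r][1/xᵢʳ]` of the vertex ideal of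
the Veronese cone at the pure power `xᵢʳ` is a regular ring: the parametrisation
`ψ : k[T₁,…,Tₙ] → VR[n,r][VM/xᵢʳ]`, `Tᵢ ↦ xᵢʳ`, `Tⱼ ↦ xⱼ/xᵢ = (xⱼxᵢ^{r-1})/xᵢʳ` (`j ≠ i`)
(`MvPolynomial.eval₂Hom`, `div_mem_blowupAlgebra`) is bijective (`veroneseConeChart_bijective`),
so the chart is `k[xᵢʳ, xⱼ/xᵢ (j ≠ i)] ≅ 𝔸ⁿ`, regular by Mathlib's instance for `MvPolynomial`
moved along `IsRegularRing.of_ringEquiv`. [folklore; Kollár 2007 §2.2 (blow-up of a vertex)] -/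
theorem stub_veronese_chart_isRegularRing (n r : ℕ) (hr : 1 ≤ r) (i : Fin n) (xi : ↥VR[n, r])
    (hxi : (xi : MP[n]) = MvPolynomial.X i ^ r) :
    IsRegularRing ↥(blowupAlgebra VM[n, r] xi) := by
  letI hAlg : Algebra (↥VR[n, r]) ↥(blowupAlgebra VM[n, r] xi) :=
    (blowupAlgebra VM[n, r] xi).algebra
  -- the degree-`r` monomials `xⱼ xᵢ^{r-1}` lie in the vertex ideal
  have hmI : ∀ j : Fin n, (⟨MvPolynomial.X j * MvPolynomial.X i ^ (r - 1),
      veroneseConeChart_X_mul_X_pow_mem k n r hr i j⟩ : ↥VR[n, r]) ∈ VM[n, r] := fun j =>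
    Ideal.subset_span ⟨Finsupp.single j 1 + Finsupp.single i (r - 1),
      veroneseConeChart_degree_single_add n r hr i j, veroneseConeChart_X_mul_X_pow_eq k n r i j⟩
  -- the chart parametrisation `ψ : k[T₁,…,Tₙ] → A[VM/xᵢʳ]`, `Tᵢ ↦ xᵢʳ`, `Tⱼ ↦ (xⱼxᵢ^{r-1})/xᵢʳ`
  let F : Fin n → ↥(blowupAlgebra VM[n, r] xi) :=
    Function.update (fun j => ⟨_, div_mem_blowupAlgebra _ xi (hmI j)⟩) i
      (algebraMap (↥VR[n, r]) _ xi)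
  let ψ : MP[n] →+* ↥(blowupAlgebra VM[n, r] xi) :=
    MvPolynomial.eval₂Hom ((algebraMap (↥VR[n, r]) _).comp (algebraMap k (↥VR[n, r]))) F
  have hψC : ∀ c, (ψ (MvPolynomial.C c) : Localization.Away xi) =
      algebraMap (↥VR[n, r]) (Localization.Away xi) (algebraMap k (↥VR[n, r]) c) := by
    intro c
    simp only [ψ, MvPolynomial.coe_eval₂Hom, MvPolynomial.eval₂_C, RingHom.comp_apply]
    rfl
  have hψi : (ψ (MvPolynomial.X i) : Localization.Away xi) =
      algebraMap (↥VR[n, r]) (Localization.Away xi) xi := by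
    simp only [ψ, F, MvPolynomial.coe_eval₂Hom, MvPolynomial.eval₂_X, Function.update_self]
    rfl
  have hψj : ∀ j, j ≠ i → (ψ (MvPolynomial.X j) : Localization.Away xi) =
      algebraMap (↥VR[n, r]) (Localization.Away xi)
        ⟨MvPolynomial.X j * MvPolynomial.X i ^ (r - 1),
          veroneseConeChart_X_mul_X_pow_mem k n r hr i j⟩ *
        IsLocalization.Away.invSelf xi := by
    intro j hj
    simp only [ψ, F, MvPolynomial.coe_eval₂Hom, MvPolynomial.eval₂_X, Function.update_of_ne hj]
  -- transport regularity of `k[T₁,…,Tₙ]` along the ring isomorphism `ψ`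
  exact IsRegularRing.of_ringEquiv
    (RingEquiv.ofBijective ψ (veroneseConeChart_bijective k n r hr i xi hxi ψ hψC hψi hψj))

end Cones

end Summit.ResolutionOfSingularities.ResolutionOfSingularities.Theorems.FRationalResolution

end
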